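import Summits.AnomalousDissipation.AnomalousDissipation.Theorems.SolenoidalFractalHomogenisationLagrangianStepVmodGeneratorProp
import Summits.AnomalousDissipation.AnomalousDissipation.Theorems.SolenoidalFractalHomogenisationLagrangianStepVmodSSReduce
import HarnessLib

/-!
# K1L_D (stmt-AnomalousDissipation-27980): (V_mod) flat stage, block (ss) — REGIME LEMMAS IN THE FINAL CURRENCY, part A:
# the loss weight from below, the trivial bound, and the two short-window regimes (T-G for `Rτ ≤ 1, τ ≤ P`; trivial for `Rτ ≥ 1, τ ≤ P`)
(helper; `--supports 27980 --as helper`; prover ad-sawtooth-k1loc-p1 g15; rows «τ ≤ P» of the certifier's table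
`Cruxes/LagrangianRenormalisationStep/Lines/onelevel-ss-regimes.md`; target currency = `VmodFlat.SSMode_textEH`.)

With `R = 8π²·loT·|ℓ|²` and the window length `τ = t − s`, the target of `SSMode_textEH` reads `defect ≤ A(τ)·dW(τ)·‖𝓕v(ℓ)‖`,
`A(τ) = C₁(C₁(ν^e + (⌈K/ν⌉/n)^e) + (min 1 (P/τ))^e)`, `dW(τ) = 1 − exp(−Rτ)`, `P = M·W.period/ν`.
* `one_sub_exp_neg_ge` — `1 − e^{−x} ≥ ½·min 1 x` (`x ≥ 0`);
* `norm_fc_le_norm`, `norm_eq_sqrt_two_mul_of_pair`, `defect_le_three_mul` — Bessel, `‖v‖ = √2‖𝓕v(ℓ)‖` on a real pair, `defect ≤ 3‖𝓕v(ℓ)‖`;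
* **`defect_le_alw_of_short_gen`** — `Rτ ≤ 1`, `τ ≤ P`, any slow label with `2|ℓ| < n`: from `…VmodGeneratorProp` with `C₁ ≥ 2·KG·Λ/(8π²c·lo)`;
* **`defect_le_alw_of_short_triv`** — `Rτ ≥ 1`, `τ ≤ P`: the trivial bound with `C₁ ≥ 6`.
`sorry`-free; NOT a proof of (ss), of the stub, of K1L_D or of AD; rung F-D1.A0.
-/

set_option linter.dupNamespace false

noncomputable section

namespace Summit.AnomalousDissipation.AnomalousDissipation.Theorems.SolenoidalFractalHomogenisation.LagrangianStep.VmodGen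

open Set MeasureTheory Complex UnitAddTorus
open scoped InnerProductSpace ENNReal
open Literature.Analysis Literature.Analysis.FunctionSpaces Literature.Analysis.FunctionSpaces.Torus
open Literature.Analysis.FluidPDE Literature.Analysis.FluidPDE.Torus Literature.Analysis.FluidPDE.LatticeShear
open Summit.AnomalousDissipation.AnomalousDissipation.Theorems.SolenoidalFractalHomogenisation.LagrangianStep.Sideband (slotAmp)
open Summit.AnomalousDissipation.AnomalousDissipation.Theorems.SolenoidalFractalHomogenisation.LagrangianStep.VmodFlat (fc fc_sub loT dW)

/-! ## §1 Scalar tools -/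

/-- `1 − e^{−x} ≥ ½·min(1, x)` for `x ≥ 0`. -/
theorem one_sub_exp_neg_ge {x : ℝ} (hx : 0 ≤ x) : (1 / 2) * min 1 x ≤ 1 - Real.exp (-x) := by
  by_cases h1 : x ≤ 1
  · rw [min_eq_right h1]
    -- `e^{−x} ≤ 1/(1+x)` hence `1 − e^{−x} ≥ x/(1+x) ≥ x/2`
    have he : Real.exp (-x) * (1 + x) ≤ 1 := by
      have h := Real.add_one_le_exp x
      have hpos := Real.exp_pos (-x)
      have e : Real.exp (-x) * Real.exp x = 1 := by rw [← Real.exp_add, neg_add_cancel, Real.exp_zero]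
      nlinarith [mul_le_mul_of_nonneg_left h hpos.le]
    nlinarith [Real.exp_pos (-x)]
  · push Not at h1
    rw [min_eq_left h1.le]
    have h2 : Real.exp (-x) ≤ Real.exp (-1) := Real.exp_le_exp.2 (by linarith)
    have h3 : Real.exp (-1) ≤ 1 / 2 := by
      have h := Real.add_one_le_exp (1:ℝ)
      have e : Real.exp (-1) * Real.exp 1 = 1 := by rw [← Real.exp_add, neg_add_cancel, Real.exp_zero]
      have hpos := Real.exp_pos (-1:ℝ)
      nlinarith
    linarith

/-- Bessel on `V2`: `‖𝓕x(k)‖ ≤ ‖x‖`. -/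
theorem norm_fc_le_norm (x : V2) (k : Fin 3 → ℤ) : ‖fc x k‖ ≤ ‖x‖ := by
  have h := sum_le_hasSum {k} (fun k' _ => sq_nonneg ‖fc x k'‖) (hasSum_norm_sq_fcoeff x)
  rw [Finset.sum_singleton] at h
  exact (pow_le_pow_iff_left₀ (norm_nonneg _) (norm_nonneg _) two_ne_zero).1 h

/-- `‖v‖ = √2·‖𝓕v(ℓ)‖` for a real `V2` pair datum at `ℓ ≠ 0`. -/
theorem norm_eq_sqrt_two_mul_of_pair {ℓ : Fin 3 → ℤ} (hℓ : ℓ ≠ 0) (v : V2) (hvs : ∀ k', k' ≠ ℓ → k' ≠ -ℓ → fc v k' = 0) :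
    ‖v‖ = Real.sqrt 2 * ‖fc v ℓ‖ := by
  have h := integral_norm_sq_eq_two_mul_of_pair hℓ v hvs (Lp.memLp v) (Filter.EventuallyEq.refl _ _)
  rw [← OneLevelSplit.norm_sq_eq_integral] at h
  rw [← Real.sqrt_sq (norm_nonneg v), h, Real.sqrt_mul (by norm_num), Real.sqrt_sq (norm_nonneg _)]

/-- **The trivial bound**: for contractions `U, T` of `V2` and a real pair datum, `‖𝓕(Uv − Tv)(ℓ)‖ ≤ 3‖𝓕v(ℓ)‖`. -/
theorem defect_le_three_mul {ℓ : Fin 3 → ℤ} (hℓ : ℓ ≠ 0) (A B : V2 →L[ℝ] V2) (hA : ∀ y, ‖A y‖ ≤ ‖y‖) (hB : ∀ y, ‖B y‖ ≤ ‖y‖)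
    (v : V2) (hvs : ∀ k', k' ≠ ℓ → k' ≠ -ℓ → fc v k' = 0) : ‖fc (A v - B v) ℓ‖ ≤ 3 * ‖fc v ℓ‖ := by
  rw [fc_sub]
  have h1 : ‖fc (A v) ℓ‖ ≤ ‖v‖ := (norm_fc_le_norm _ _).trans (hA v)
  have h2 : ‖fc (B v) ℓ‖ ≤ ‖v‖ := (norm_fc_le_norm _ _).trans (hB v)
  have h3 := norm_eq_sqrt_two_mul_of_pair hℓ v hvs
  have hs2 : Real.sqrt 2 ≤ 3 / 2 := by
    rw [show (3:ℝ) / 2 = Real.sqrt ((3/2) ^ 2) by rw [Real.sqrt_sq (by norm_num)]]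
    exact Real.sqrt_le_sqrt (by norm_num)
  calc ‖fc (A v) ℓ - fc (B v) ℓ‖ ≤ ‖fc (A v) ℓ‖ + ‖fc (B v) ℓ‖ := norm_sub_le _ _
    _ ≤ ‖v‖ + ‖v‖ := add_le_add h1 h2
    _ = 2 * Real.sqrt 2 * ‖fc v ℓ‖ := by rw [h3]; ring
    _ ≤ 3 * ‖fc v ℓ‖ := by nlinarith [norm_nonneg (fc v ℓ)]

/-- The allowance dominates `C₁` on windows `τ ≤ P`: `C₁ ≤ C₁(C₁(a + b) + (min 1 (P/τ))^e)` (`a, b, C₁ ≥ 0`, `P/τ ≥ 1`). -/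
theorem C1_le_alw {C₁ a b P τ e : ℝ} (hC₁ : 0 ≤ C₁) (ha : 0 ≤ a) (hb : 0 ≤ b) (hτ : 0 < τ) (hτP : τ ≤ P) :
    C₁ ≤ C₁ * (C₁ * (a + b) + (min 1 (P / τ)) ^ e) := by
  have hmin : min 1 (P / τ) = 1 := min_eq_left ((one_le_div hτ).2 hτP)
  rw [hmin, Real.one_rpow]
  nlinarith [mul_nonneg hC₁ (mul_nonneg hC₁ (add_nonneg ha hb))]

/-! ## §2 The two short-window regimes -/

section Clause

variable {k : ℕ} {W : LatticeWord k} {M : ℝ} {hM : 0 < M} {c : ℝ}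
  {Φ : ℝ → Visc4 (Fin 3) → Visc4 (Fin 3)} {lo hi Λ β σ C ν₀ K : ℝ}
  {ν : ℝ} {n : ℕ} {𝔸 : Visc4 (Fin 3)} {Tw : ℝ} {U T : ℝ → ℝ → (V2 →L[ℝ] V2)}

set_option maxHeartbeats 1600000 in
/-- **SHORT WINDOWS, GENERATOR REGIME** (`Rτ ≤ 1`, `τ ≤ P`; every slow label with `2|ℓ| < n`): the target inequality with
`C₁ ≥ 2·KG·Λ/(8π²·c·lo)`, `KG = 4π²c(hiΛ + β/2) + 32√2Λ(Σⱼ‖αⱼ‖)²/lo`. -/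
theorem defect_le_alw_of_short_gen (hlo : 0 < lo) (hhi : 0 ≤ hi) (hΛ : 1 ≤ Λ) (hβ : 0 ≤ β) (hc : 0 < c)
    (hν : ν ∈ Set.Ioo 0 ν₀) (hn : 1 ≤ n)
    (hwin : ∃ lam ∈ Set.Icc (1:ℝ) Λ, NearIso 𝔸 (ν * (lo / lam)) (ν * (hi * lam)))
    (hΦo : OddSmall (Φ ν ((1 / ν) • 𝔸)) β) (hΦw : ∃ lam ∈ Set.Icc (1:ℝ) Λ, NearIso (Φ ν ((1 / ν) • 𝔸)) (lo / lam) (hi * lam))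
    (hU : IsPropagator Tw (cellField W M hM ν hν.1 n) ((1 / (n:ℝ) ^ 2) • 𝔸) U)
    (hT : IsPropagator Tw (fun (_ : ℝ) (_ : UnitAddTorus (Fin 3)) => (0 : EuclideanSpace ℝ (Fin 3)))
      ((1 / (n:ℝ) ^ 2) • (𝔸 + (c / ν) • Φ ν ((1 / ν) • 𝔸))) T)
    {s t : ℝ} (hs : 0 ≤ s) (hst : s < t) (htT : t ≤ Tw) (hphase : ∀ τ, cellField W M hM ν hν.1 n (s + τ) = cellField W M hM ν hν.1 n τ)
    {ℓ : Fin 3 → ℤ} (hℓ0 : ℓ ≠ 0) (hℓn : 2 * Real.sqrt (freqNormSq ℓ) < n)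
    (v : V2) (hv : v ∈ divFreeL2 (Fin 3)) (hvs : ∀ k', k' ≠ ℓ → k' ≠ -ℓ → fc v k' = 0)
    {C₁ e : ℝ} (hC₁0 : 0 ≤ C₁)
    (hC₁ : 2 * ((4 * Real.pi ^ 2 * c * (hi * Λ + β / 2) + 32 * Real.sqrt 2 * Λ * (∑ j, ‖slotAmp W j‖) ^ 2 / lo) * Λ /
      (8 * Real.pi ^ 2 * c * lo)) ≤ C₁)
    (hRτ : 8 * Real.pi ^ 2 * loT lo Λ c ν n * Torus.freqNormSq ℓ * (t - s) ≤ 1) (hτP : t - s ≤ M * W.period / ν) :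
    ‖fc (U s t v - T s t v) ℓ‖
      ≤ (C₁ * (C₁ * (ν ^ e + ((⌈K / ν⌉₊ : ℝ) / n) ^ e) + (min 1 ((M * W.period / ν) / (t - s))) ^ e))
        * dW lo Λ c ν n (t - s) ℓ * ‖fc v ℓ‖ := by
  have hτ0 : 0 < t - s := by linarith
  have hsT : s < Tw := lt_of_lt_of_le hst htT
  have hn0 : (0:ℝ) < n := by exact_mod_cast (show 0 < n from hn)
  have hΛ0 : 0 < Λ := lt_of_lt_of_le one_pos hΛ
  -- the generator bound
  have hgen := norm_fc_sub_le_generator W M hM hc.le hlo hhi hΛ hβ hν.1 hn hwin hΦo hΦw hU hT hs hst.le htT hsT hphase hℓ0 hℓn v hv hvs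
  set KG : ℝ := 4 * Real.pi ^ 2 * c * (hi * Λ + β / 2) + 32 * Real.sqrt 2 * Λ * (∑ j, ‖slotAmp W j‖) ^ 2 / lo with hKG
  have hKG0 : 0 ≤ KG := by rw [hKG]; positivity
  set R : ℝ := 8 * Real.pi ^ 2 * loT lo Λ c ν n * Torus.freqNormSq ℓ with hR
  -- `KG·(|ℓ|²/(n²ν))·τ ≤ (KG·Λ/(8π²c·lo))·Rτ`
  have hq : freqNormSq ℓ / ((n:ℝ) ^ 2 * ν) ≤ Λ / (8 * Real.pi ^ 2 * c * lo) * R := by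
    rw [hR]; unfold loT
    have hq0 := freqNormSq_nonneg ℓ
    -- `R ≥ 8π²·(c/ν)·(lo/Λ)·|ℓ|²/n²`
    have h1 : 8 * Real.pi ^ 2 * ((1 / (n:ℝ) ^ 2) * ((c / ν) * (lo / Λ))) * freqNormSq ℓ
        ≤ 8 * Real.pi ^ 2 * ((1 / (n:ℝ) ^ 2) * ((ν + c / ν) * (lo / Λ))) * freqNormSq ℓ := by
      have : c / ν ≤ ν + c / ν := by linarith [hν.1]
      have : (c / ν) * (lo / Λ) ≤ (ν + c / ν) * (lo / Λ) := mul_le_mul_of_nonneg_right this (div_pos hlo hΛ0).le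
      have h3 : (1 / (n:ℝ) ^ 2) * ((c / ν) * (lo / Λ)) ≤ (1 / (n:ℝ) ^ 2) * ((ν + c / ν) * (lo / Λ)) :=
        mul_le_mul_of_nonneg_left this (by positivity)
      exact mul_le_mul_of_nonneg_right (mul_le_mul_of_nonneg_left h3 (by positivity)) hq0
    have e1 : freqNormSq ℓ / ((n:ℝ) ^ 2 * ν) =
        Λ / (8 * Real.pi ^ 2 * c * lo) * (8 * Real.pi ^ 2 * ((1 / (n:ℝ) ^ 2) * ((c / ν) * (lo / Λ))) * freqNormSq ℓ) := by
      field_simp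
    rw [e1]
    exact mul_le_mul_of_nonneg_left h1 (by positivity)
  have hdefect : ‖fc (U s t v - T s t v) ℓ‖ ≤ (KG * Λ / (8 * Real.pi ^ 2 * c * lo)) * (R * (t - s)) * ‖fc v ℓ‖ := by
    refine hgen.trans ?_
    have := mul_le_mul_of_nonneg_left hq hKG0
    have h2 : KG * (freqNormSq ℓ / ((n:ℝ) ^ 2 * ν)) * (t - s) ≤ (KG * Λ / (8 * Real.pi ^ 2 * c * lo)) * (R * (t - s)) := by
      have := mul_le_mul_of_nonneg_right this hτ0.le
      calc KG * (freqNormSq ℓ / ((n:ℝ) ^ 2 * ν)) * (t - s) ≤ KG * (Λ / (8 * Real.pi ^ 2 * c * lo) * R) * (t - s) := this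
        _ = (KG * Λ / (8 * Real.pi ^ 2 * c * lo)) * (R * (t - s)) := by ring
    exact mul_le_mul_of_nonneg_right h2 (norm_nonneg _)
  -- the loss weight from below: `dW ≥ Rτ/2`
  have hRτ0 : 0 ≤ R * (t - s) := by
    rw [hR]; unfold loT
    have := freqNormSq_nonneg ℓ; have := hν.1; have : 0 ≤ ν + c / ν := by positivity
    positivity
  have hdW : (1 / 2) * (R * (t - s)) ≤ dW lo Λ c ν n (t - s) ℓ := by
    have h := one_sub_exp_neg_ge hRτ0
    rw [min_eq_right (by rw [hR]; exact hRτ)] at h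
    unfold dW
    rw [show 8 * Real.pi ^ 2 * loT lo Λ c ν n * Torus.freqNormSq ℓ * (t - s) = R * (t - s) by rw [hR]]
    exact h
  -- the allowance dominates `C₁ ≥ 2cG`
  have halw : C₁ ≤ C₁ * (C₁ * (ν ^ e + ((⌈K / ν⌉₊ : ℝ) / n) ^ e) + (min 1 ((M * W.period / ν) / (t - s))) ^ e) :=
    C1_le_alw hC₁0 (Real.rpow_nonneg hν.1.le e) (Real.rpow_nonneg (by positivity) e) hτ0 hτP
  have hcG0 : 0 ≤ KG * Λ / (8 * Real.pi ^ 2 * c * lo) := by positivity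
  calc ‖fc (U s t v - T s t v) ℓ‖ ≤ (KG * Λ / (8 * Real.pi ^ 2 * c * lo)) * (R * (t - s)) * ‖fc v ℓ‖ := hdefect
    _ ≤ (KG * Λ / (8 * Real.pi ^ 2 * c * lo)) * (2 * dW lo Λ c ν n (t - s) ℓ) * ‖fc v ℓ‖ := by
        refine mul_le_mul_of_nonneg_right (mul_le_mul_of_nonneg_left (by linarith) hcG0) (norm_nonneg _)
    _ = (2 * (KG * Λ / (8 * Real.pi ^ 2 * c * lo))) * dW lo Λ c ν n (t - s) ℓ * ‖fc v ℓ‖ := by ring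
    _ ≤ C₁ * dW lo Λ c ν n (t - s) ℓ * ‖fc v ℓ‖ := by
        have hdW0 : 0 ≤ dW lo Λ c ν n (t - s) ℓ := le_trans (by positivity) hdW
        exact mul_le_mul_of_nonneg_right (mul_le_mul_of_nonneg_right (by rw [hKG] at hC₁ ⊢; exact hC₁) hdW0) (norm_nonneg _)
    _ ≤ _ := by
        have hdW0 : 0 ≤ dW lo Λ c ν n (t - s) ℓ := le_trans (by positivity) hdW
        exact mul_le_mul_of_nonneg_right (mul_le_mul_of_nonneg_right halw hdW0) (norm_nonneg _)

/-- **SHORT WINDOWS, SATURATED LOSS** (`Rτ ≥ 1`, `τ ≤ P`): the target inequality with `C₁ ≥ 6` (trivial bound, `dW ≥ ½`). -/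
theorem defect_le_alw_of_short_triv (hν : ν ∈ Set.Ioo 0 ν₀) (hn : 1 ≤ n)
    (hU : IsPropagator Tw (cellField W M hM ν hν.1 n) ((1 / (n:ℝ) ^ 2) • 𝔸) U)
    (hT : IsPropagator Tw (fun (_ : ℝ) (_ : UnitAddTorus (Fin 3)) => (0 : EuclideanSpace ℝ (Fin 3)))
      ((1 / (n:ℝ) ^ 2) • (𝔸 + (c / ν) • Φ ν ((1 / ν) • 𝔸))) T)
    {s t : ℝ} (hst : s < t)
    {ℓ : Fin 3 → ℤ} (hℓ0 : ℓ ≠ 0) (v : V2) (hvs : ∀ k', k' ≠ ℓ → k' ≠ -ℓ → fc v k' = 0)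
    {C₁ e : ℝ} (hC₁ : 6 ≤ C₁)
    (hRτ : 1 ≤ 8 * Real.pi ^ 2 * loT lo Λ c ν n * Torus.freqNormSq ℓ * (t - s)) (hτP : t - s ≤ M * W.period / ν) :
    ‖fc (U s t v - T s t v) ℓ‖
      ≤ (C₁ * (C₁ * (ν ^ e + ((⌈K / ν⌉₊ : ℝ) / n) ^ e) + (min 1 ((M * W.period / ν) / (t - s))) ^ e))
        * dW lo Λ c ν n (t - s) ℓ * ‖fc v ℓ‖ := by
  have hτ0 : 0 < t - s := by linarith
  have hn0 : (0:ℝ) < n := by exact_mod_cast (show 0 < n from hn)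
  have hC₁0 : 0 ≤ C₁ := by linarith
  have htriv := defect_le_three_mul hℓ0 (U s t) (T s t) (hU.norm_le s t) (hT.norm_le s t) v hvs
  have hRτ0 : 0 ≤ 8 * Real.pi ^ 2 * loT lo Λ c ν n * Torus.freqNormSq ℓ * (t - s) := le_trans zero_le_one hRτ
  have hdW : (1 / 2 : ℝ) ≤ dW lo Λ c ν n (t - s) ℓ := by
    have h := one_sub_exp_neg_ge hRτ0
    rw [min_eq_left hRτ] at h
    unfold dW
    linarith
  have halw : C₁ ≤ C₁ * (C₁ * (ν ^ e + ((⌈K / ν⌉₊ : ℝ) / n) ^ e) + (min 1 ((M * W.period / ν) / (t - s))) ^ e) :=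
    C1_le_alw hC₁0 (Real.rpow_nonneg hν.1.le e) (Real.rpow_nonneg (by positivity) e) hτ0 hτP
  have hv0 := norm_nonneg (fc v ℓ)
  calc ‖fc (U s t v - T s t v) ℓ‖ ≤ 3 * ‖fc v ℓ‖ := htriv
    _ ≤ C₁ * (1 / 2) * ‖fc v ℓ‖ := by nlinarith
    _ ≤ C₁ * dW lo Λ c ν n (t - s) ℓ * ‖fc v ℓ‖ := mul_le_mul_of_nonneg_right (mul_le_mul_of_nonneg_left hdW hC₁0) hv0
    _ ≤ _ := by
        have hdW0 : 0 ≤ dW lo Λ c ν n (t - s) ℓ := le_trans (by norm_num) hdW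
        exact mul_le_mul_of_nonneg_right (mul_le_mul_of_nonneg_right halw hdW0) hv0

end Clause

end Summit.AnomalousDissipation.AnomalousDissipation.Theorems.SolenoidalFractalHomogenisation.LagrangianStep.VmodGen

end
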